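import Mathlib
import HarnessLib
import Summits.Langlands.Langlands.Statement
import Summits.Langlands.Langlands.Theorems.SkinnerWilesDefectOneEisensteinProModularSeedEisensteinPackageQ
import Literature.NumberTheory.EllipticCurves.EisensteinNewformLevelRaising

/-!
# Item `SeedOfQuadraticBaseChange` (stmt-Langlands-15158): the `ℚ`-side Eisenstein package for
# EVERY ODD PRIME `p` (stub S2' of the seed's line `descend-raise-basechange` without `p ≥ 5`)

The landed stub S2' `EisensteinProModularSeed.stub_eisensteinPackageQ` (p94046) carries `5 ≤ p` for
ONE reason only: its first named fact `BillereyMenares2016_thm22_exists_newform` renders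
Billerey–Menares 2016 Thm. 2.2 with `p ≥ 5` (the line was planned on the Billerey–Menares WINDOW of
the 2018 paper, where `l ≥ 5`).  The 2016 theorem itself is stated and proved for EVERY prime `l`
(arXiv:1309.3717 §2, p. 7: the weight is `k = 4 (l = 2)`, `l (b = 0, l ≥ 3)`, `l + 1 (b = 1)`,
`b + 1 (b ≥ 2)`; Thm. 2.2 has no hypothesis on `l`).  At `l = 3` the Billerey–Menares weights are
`k = 3 (b = 0)` and `k = 4 (b = 1)`, and the one case in which `B_{k,ε₀}/2k` fails to be
`λ`-integral — `ε₀ω^k = 1`, i.e. `ε₀ = 1 ∧ (l - 1) ∣ k` (Washington Cor. 5.13 / von Staudt–Clausen)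
— is now `k = l + 1 = 4` (not `k = l - 1` as for `l ≥ 5`); in every case it is met by
`M^{l-1} ≡ 1 (mod l²)` (then `M^k ≡ 1 (mod l²)` as `(l-1) ∣ k`).  Hence the named fact below,
`BillereyMenares2016_thm22_exists_newform_odd`: the landed rendering VERBATIM with `p ≠ 2` in place
of `5 ≤ p` and the von Staudt clause keyed on `(p - 1) ∣ k` instead of `k + 1 = p` (equivalent for
`p ≥ 5` on the Billerey–Menares weights, so the landed fact is a corollary —
`billereyMenares2016_thm22_of_odd` in the companion file `…SeedOfQuadraticBaseChangeOddPrimes`).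
With it, the landed proof of S2' goes through word for word for every odd `p`
(`eisensteinPackageQ_odd`; `5 ≤ p` was used there only to call the fact): this removes `p = 3` from
the conceded residual regime of the seed crux (the lead's "p = 3 side-stub" of S6'), so that item
stmt-Langlands-15158 reduces to GENUINE residual pairs alone (companion file).
-/

set_option linter.dupNamespace false -- project-wide option (lakefile weak.linter.dupNamespace); `Summit.Langlands.Langlands` is the mandated namespace

noncomputable section

namespace Summit.Langlands.Langlands.Theorems.SkinnerWilesDefectOne.SeedOfQuadraticBaseChange

open Literature.NumberTheory.GaloisRepresentations Literature.NumberTheory.Automorphic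
open Literature.NumberTheory.EllipticCurves.ModularForms NumberField IsDedekindDomain IsLocalRing Field
open scoped MatrixGroups Matrix

/-! ### The named fact: Billerey–Menares 2016 Thm. 2.2 for every odd `l` -/

section OddPackage

open Summit.Langlands.Langlands.Theorems.SkinnerWilesDefectOne.EisensteinProModularSeed

/-- **`eisensteinPackageQ_odd` — the `ℚ`-side package of the seed's line for EVERY ODD `p`.**  The
landed S2' `EisensteinProModularSeed.stub_eisensteinPackageQ` (p94046) verbatim with `p ≠ 2` in
place of `5 ≤ p` and the named fact `BillereyMenares2016_thm22_exists_newform_odd` in place of its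
`p ≥ 5` rendering; CONDITIONAL on the same five published theorems otherwise (Hida *MFG* Thm. 3.26
(1), (2) with the unit root, (3)(a); Gelbart Thm. 5.19), prepended in the same order.  For `O =
𝒪_{ℚ̄_p}`, a continuous unit-valued `η : Γ_ℚ → ℚ̄_pˣ` with ODD reduction, non-trivial on a
decomposition group at `p` (DIST), and a prime `M ≠ p` with `η̄` unramified at `M`,
`η̄(Frob_M) ≡ -1`, `M ≡ -1 (mod p²)`: `k ≥ 2`, an irreducible `ρ' : Γ_ℚ → GL₂(ℚ̄_p)` with an
integral model of ORDERED residual diagonal `(1, η̄)`, an ORIENTED ordinary frame at `p` of inertial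
type `(ε^{k-1}, 1)`, the level property off `Mp`, and the modularity clause.  Proof: the landed
proof word for word (its steps: Billerey–Menares weight `exists_bmWeight`, which needs only `p ≠ 2`;
`η̄(Frob_M)M ≡ 1` and `M^{p-1} ≡ 1 (mod p²)` from `M ≡ -1 (mod p²)`, which discharges the von Staudt
clause whatever its antecedent; the newform; `ρ_{g,ι}`; the ordinary frame with unit root `≡ 1`; the
eigenframe of complex conjugation and Ribet's frame, oriented at the DIST element; (lev); (mod)). -/
theorem eisensteinPackageQ_odd :
    Literature.NumberTheory.EllipticCurves.BillereyMenares2016_thm22_exists_newform_odd → Literature.NumberTheory.EllipticCurves.Hida2000_thm326_exists_galoisRep →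
    Literature.NumberTheory.EllipticCurves.Hida2000_thm326_ordinary_unitRoot → Literature.NumberTheory.EllipticCurves.Hida2000_thm326_inertia_of_level →
    Literature.NumberTheory.EllipticCurves.Gelbart1975_exists_cuspidalRepData_LAlgebraic →
    ∀ (p : ℕ) [Fact p.Prime], p ≠ 2 → ∀ (O : ValuationSubring (PadicAlgCl p)),
      O = (Valued.v : Valuation (PadicAlgCl p) NNReal).valuationSubring →
      ∀ (η : Field.absoluteGaloisGroup ℚ →ₜ* (PadicAlgCl p)ˣ) (M : ℕ),
      (∀ τ, Valued.v ((η τ : (PadicAlgCl p)ˣ) : PadicAlgCl p) = 1) →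
      (∀ c : Field.absoluteGaloisGroup ℚ, Literature.NumberTheory.GaloisRepresentations.IsComplexConjugation (Rat.castHom ℝ) c →
        Valued.v (((η c : (PadicAlgCl p)ˣ) : PadicAlgCl p) + 1) < 1) →
      (∀ w : IsDedekindDomain.HeightOneSpectrum (NumberField.RingOfIntegers ℚ), (p : NumberField.RingOfIntegers ℚ) ∈ w.asIdeal →
        ∃ 𝔓 ∈ w.primesAbove, ∃ σ : Field.absoluteGaloisGroup ℚ, (∀ x ∈ 𝔓, σ • x ∈ 𝔓) ∧
          ¬ Valued.v (((η σ : (PadicAlgCl p)ˣ) : PadicAlgCl p) - 1) < 1) →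
      M.Prime → M ≠ p →
      (∀ w : IsDedekindDomain.HeightOneSpectrum (NumberField.RingOfIntegers ℚ), (M : NumberField.RingOfIntegers ℚ) ∈ w.asIdeal → ∀ 𝔓 ∈ w.primesAbove,
        ∀ σ ∈ 𝔓.inertia (Field.absoluteGaloisGroup ℚ),
          Valued.v (((η σ : (PadicAlgCl p)ˣ) : PadicAlgCl p) - 1) < 1) →
      (∀ w : IsDedekindDomain.HeightOneSpectrum (NumberField.RingOfIntegers ℚ), (M : NumberField.RingOfIntegers ℚ) ∈ w.asIdeal → ∀ 𝔓 ∈ w.primesAbove,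
        ∀ σ : Field.absoluteGaloisGroup ℚ, IsArithFrobAt (NumberField.RingOfIntegers ℚ) σ 𝔓 →
          Valued.v (((η σ : (PadicAlgCl p)ˣ) : PadicAlgCl p) + 1) < 1) →
      M % (p ^ 2) = p ^ 2 - 1 →
      ∃ (k : ℕ) (ρ' : Literature.NumberTheory.GaloisRepresentations.FramedGaloisRep ℚ (PadicAlgCl p) 2)
        (ρ'₀ : Field.absoluteGaloisGroup ℚ →* Matrix.GeneralLinearGroup (Fin 2) O),
        2 ≤ k ∧ ρ'.toGaloisRep.IsIrreducible ∧ ρ'.HasUpperTriangularIntegralModel ρ'₀ ∧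
        (∀ g, ((ρ'₀ g).val 0 0 - 1 : O) ∈ IsLocalRing.maximalIdeal O ∧
          Valued.v (((ρ'₀ g).val 1 1 : PadicAlgCl p) - ((η g : (PadicAlgCl p)ˣ) : PadicAlgCl p)) < 1) ∧
        (∀ w : IsDedekindDomain.HeightOneSpectrum (NumberField.RingOfIntegers ℚ), (p : NumberField.RingOfIntegers ℚ) ∈ w.asIdeal →
          ∃ Q : Matrix.GeneralLinearGroup (Fin 2) (PadicAlgCl p),
            Valued.v (Q.val 0 0) ≤ Valued.v (Q.val 1 0) ∧
            ∀ σ, (Q⁻¹ * ρ'.toLocal w σ * Q).val 1 0 = 0 ∧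
              (σ ∈ Literature.NumberTheory.GaloisRepresentations.absInertia (w.adicCompletion ℚ) →
                (Q⁻¹ * ρ'.toLocal w σ * Q).val 1 1 = 1 ∧
                (Q⁻¹ * ρ'.toLocal w σ * Q).val 0 0 =
                  algebraMap (Padic p) (PadicAlgCl p)
                    (((Literature.NumberTheory.GaloisRepresentations.GaloisRep.cyclotomicCharacter (w.adicCompletion ℚ) p σ).val : PadicInt p) :
                      Padic p) ^ (k - 1))) ∧
        (∀ w : IsDedekindDomain.HeightOneSpectrum (NumberField.RingOfIntegers ℚ), (M : NumberField.RingOfIntegers ℚ) ∉ w.asIdeal → (p : NumberField.RingOfIntegers ℚ) ∉ w.asIdeal →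
          ∀ 𝔓 ∈ w.primesAbove, ∀ σ ∈ 𝔓.inertia (Field.absoluteGaloisGroup ℚ),
            Valued.v (((η σ : (PadicAlgCl p)ˣ) : PadicAlgCl p) - 1) < 1 → ρ' σ = 1) ∧
        ∀ hcpt : Literature.NumberTheory.Automorphic.isCompact_glFiniteIntegralLevel 2 ℚ,
          ∃ (ι : PadicAlgCl p ≃+* ℂ) (π : Literature.NumberTheory.Automorphic.CuspidalAutomorphicRepData 2 ℚ hcpt) (T : Literature.NumberTheory.Automorphic.InfinityType ℚ 2),
            π.1.HasInfinityType T ∧ T.IsLAlgebraic ∧ T.IsRegular ∧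
            ∀ᶠ w in Filter.cofinite, Summit.Langlands.SatakeFrobCompatibleAt ι π.1 ρ' w := by
  intro hBM hDel hOrd hLev hGel p hp hp2 O hO η M hunit hodd hdist hMp hMne hMunr hMfrob hMsq
  classical
  have hpp : p.Prime := hp.out
  -- an abstract field isomorphism `ι : ℚ̄_p ≃ ℂ`, and the place `w₀ ∣ p`
  obtain ⟨ι⟩ := PadicAlgCl.nonempty_ringEquiv_complex p
  set w₀ : HeightOneSpectrum (𝓞 ℚ) := (Rat.HeightOneSpectrum.primesEquiv (R := 𝓞 ℚ)).symm ⟨p, hpp⟩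
    with hw₀
  have hw₀p : ((Rat.HeightOneSpectrum.primesEquiv w₀ : Nat.Primes) : ℕ) = p := by
    rw [hw₀, Equiv.apply_symm_apply]
  have hpw₀ : (p : 𝓞 ℚ) ∈ w₀.asIdeal := (natCast_mem_asIdeal_iff_primesEquiv w₀ hpp).mpr hw₀p
  have hw_eq : ∀ w : HeightOneSpectrum (𝓞 ℚ), (p : 𝓞 ℚ) ∈ w.asIdeal → w = w₀ := fun w hw =>
    Rat.HeightOneSpectrum.primesEquiv.injective (Subtype.ext (by
      rw [(natCast_mem_asIdeal_iff_primesEquiv w hpp).mp hw, hw₀p]))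
  -- STEP 1: the Billerey–Menares weight `k`
  have hp3 : 3 ≤ p := by have := hpp.two_le; omega
  obtain ⟨k, hkBM, 𝔓₁, h𝔓₁, hinert⟩ := exists_bmWeight p hp2 η hunit w₀ hpw₀
  have hk3 : 3 ≤ k := by rcases hkBM with rfl | rfl | ⟨h, -⟩ <;> omega
  have hk2 : 2 ≤ k := by omega
  -- STEP 2: the level-raising prime: `η̄(Frob_M)·M ≡ 1` and `M^(p-1) ≡ 1 (mod p²)`
  have hM1 : Valued.v ((M : PadicAlgCl p) + 1) < 1 := v_natCast_add_one_lt_one hMsq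
  have hMcong : ∀ w : HeightOneSpectrum (𝓞 ℚ), (M : 𝓞 ℚ) ∈ w.asIdeal → ∀ 𝔓 ∈ w.primesAbove,
      ∀ σ : absoluteGaloisGroup ℚ, IsArithFrobAt (𝓞 ℚ) σ 𝔓 →
        Valued.v (((η σ : (PadicAlgCl p)ˣ) : PadicAlgCl p) * (M : PadicAlgCl p) - 1) < 1 := by
    intro w hw 𝔓 h𝔓 σ hσ
    have h1 := hMfrob w hw 𝔓 h𝔓 σ hσ
    have e : ((η σ : (PadicAlgCl p)ˣ) : PadicAlgCl p) * (M : PadicAlgCl p) - 1 =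
        (((η σ : (PadicAlgCl p)ˣ) : PadicAlgCl p) + 1) * (M : PadicAlgCl p) - ((M : PadicAlgCl p) + 1) := by
      ring
    rw [e]
    exact v_sub_lt_one (v_mul_lt_one_left h1 (v_natCast_le_one M)) hM1
  have hMpow : M ^ (p - 1) % p ^ 2 = 1 := natCast_pow_sub_one_mod_sq hp2 hMsq
  -- STEP 3: the Eisenstein-congruent newform (Billerey–Menares 2016)
  obtain ⟨N, hN, g, hnew, hpN, hlevel, ⟨m, -, hpm, hχm⟩, hap, hcong⟩ :=
    hBM p hp2 ι η k M hunit hodd hkBM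
      (fun w hw => by obtain rfl := hw_eq w hw; exact ⟨𝔓₁, h𝔓₁, hinert⟩) hMp hMne hMunr hMcong
      (fun _ _ => hMpow)
  haveI := hN
  have hk2' : (2 : ℤ) ≤ (k : ℤ) := by exact_mod_cast hk2
  -- STEP 4: `ρ = ρ_{g,ι}` and the congruences on all of `Γ_ℚ`
  obtain ⟨ρ, hρg, hirr⟩ := hDel g hk2' hnew p ι
  have hirr' : FramedRep.IsIrreducible ρ := hirr
  obtain ⟨htrall, hdetall⟩ := trace_det_congr_of_newform g ι ρ hρg
    (fun σ => ((η σ : (PadicAlgCl p)ˣ) : PadicAlgCl p)) (Units.continuous_val.comp η.continuous) hcong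
  -- STEP 5: the ordinary frame at `p` with its unit root `α ≡ a_p ≡ 1`
  obtain ⟨Q, α, hαv, hαroot, hQ⟩ :=
    hOrd g hk2' hnew p ι hpN (v_eq_one_of_sub_one_lt hap) ρ hρg hirr w₀ hpw₀
  have hα1 : Valued.v (α - 1) < 1 := by
    obtain ⟨u, hu'⟩ := (ZMod.isUnit_prime_iff_not_dvd hpp).mpr hpN
    have hm0 : m ≠ 0 := fun h => hpm (h ▸ dvd_zero p)
    have hχ1 : (ι.symm (nebentypus g (p : ZMod N) : ℂ)) ^ m = 1 := by
      rw [← map_pow, ← hu', ← MulChar.pow_apply_coe, hχm, MulChar.one_apply_coe, map_one]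
    refine v_sub_one_lt_one_of_root hαv hαroot ?_ hap
    have hk1 : ((k : ℤ) - 1) = ((k - 1 : ℕ) : ℤ) := by rw [Nat.cast_sub (by omega : 1 ≤ k)]; norm_num
    rw [map_mul, hk1, zpow_natCast, map_pow, map_natCast (ι.symm : ℂ ≃+* PadicAlgCl p) p]
    exact v_mul_prime_pow_lt_one hm0 hχ1 (by omega)
  -- STEP 6: the unit-root character is `≡ 1` on all of `Γ_{ℚ_p}`
  have hδ : ∀ σ, Valued.v ((Q⁻¹ * ρ.toLocal w₀ σ * Q).val 1 1 - 1) < 1 :=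
    v_unitRoot_sub_one_lt_one (ρ.toLocal w₀) Q α hα1 (fun σ => (hQ σ).1)
      (fun σ hσ => ((hQ σ).2.1 hσ).1) (fun σ hσ => (hQ σ).2.2 hσ)
  -- STEP 7: the eigenframe of a complex conjugation `c`, Ribet's frame, the integral model
  obtain ⟨c, hc⟩ := exists_isComplexConjugation (Rat.castHom ℝ)
  obtain ⟨hcc, hdetc⟩ := det_eq_neg_one_of_odd hp2 ρ hc.sq_eq_one (hdetall c) (hodd c hc)
  obtain ⟨R, hR⟩ := exists_conj_involution_eq_diag (ρ c) hcc hdetc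
  obtain ⟨D, -, hframe⟩ := exists_residually_borel_frame ρ hirr' η hunit htrall R c
    (by rw [hR]; simp) (by rw [hR]; simp) (by rw [hR]; simp) (not_v_sub_one_lt_one hp2 (hodd c hc))
  set P := R * D with hP
  have hρ'apply : ∀ σ, FramedRep.conj P⁻¹ ρ σ = P⁻¹ * ρ σ * P := fun σ => conj_inv_apply ρ P σ
  obtain ⟨ρ'₀, hmodel, hdiag⟩ := exists_integralModel_of_frame hO ρ
    (fun σ => ((η σ : (PadicAlgCl p)ˣ) : PadicAlgCl p)) P
    (fun σ i j => (hframe σ).1 i j) (fun σ => (hframe σ).2.1) (fun σ => (hframe σ).2.2.1)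
    (fun σ => (hframe σ).2.2.2)
  refine ⟨k, FramedRep.conj P⁻¹ ρ, ρ'₀, hk2, isIrreducible_conj ρ P⁻¹ hirr', hmodel, hdiag,
    ?_, ?_, ?_⟩
  · -- (ord): the ordinary frame `Q`, transported to the new frame, is ORIENTED (DIST + unit root)
    intro w hw
    obtain rfl := hw_eq w hw
    have hconj : ∀ σ, (P⁻¹ * Q)⁻¹ * FramedGaloisRep.toLocal w₀ (FramedRep.conj P⁻¹ ρ) σ * (P⁻¹ * Q) =
        Q⁻¹ * ρ.toLocal w₀ σ * Q := fun σ => by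
      rw [FramedGaloisRep.toLocal_apply, FramedGaloisRep.toLocal_apply, hρ'apply]; group
    refine ⟨P⁻¹ * Q, ?_, fun σ => ?_⟩
    · obtain ⟨𝔓, h𝔓, σ, hσ𝔓, hσ⟩ := hdist w₀ hw
      obtain ⟨τ, σ₀, hσ₀⟩ := exists_absGaloisRestrict_eq_conj_of_forall_smul_mem w₀ h𝔓 hσ𝔓
      have hησ₀ : ¬ Valued.v (((η (absGaloisRestrict ℚ (w₀.adicCompletion ℚ) σ₀) : (PadicAlgCl p)ˣ) :
          PadicAlgCl p) - 1) < 1 := by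
        rwa [hσ₀, map_mul, map_mul, map_inv, inv_mul_cancel_comm]
      have hv : Valued.v ((Q⁻¹ * ρ.toLocal w₀ σ₀ * Q).val 1 1 - 1) < 1 := hδ σ₀
      have hmem : (Q⁻¹ * ρ.toLocal w₀ σ₀ * Q).val 1 1 ∈ O := by
        rw [hO, Valuation.mem_valuationSubring_iff]
        exact v_le_one_of_sub_lt hv (le_of_eq (Valuation.map_one _))
      refine Summit.Langlands.Langlands.Theorems.EisensteinProModularSeed.Negative.oriented_of_unitRoot_congr_toLocal
        hO hmodel w₀ (P⁻¹ * Q) σ₀ ?_ ⟨⟨_, hmem⟩, ?_, ?_⟩ ?_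
      · rw [hconj]; exact (hQ σ₀).1
      · rw [hconj]
      · have h1 : (⟨_, hmem⟩ : O) - 1 ∈ maximalIdeal O :=
          (Summit.Langlands.Langlands.Theorems.FiveIsogenyEllipticCurves.sub_mem_maximalIdeal_iff_v hO _ 1).mpr
            (by rw [OneMemClass.coe_one]; exact hv)
        have h2 := (hdiag (absGaloisRestrict ℚ (w₀.adicCompletion ℚ) σ₀)).1
        have := Ideal.sub_mem _ h1 h2
        convert this using 1
        abel
      · intro hmm
        apply hησ₀
        set γ := absGaloisRestrict ℚ (w₀.adicCompletion ℚ) σ₀ with hγ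
        have h1 : Valued.v (((ρ'₀ γ).val 0 0 : PadicAlgCl p) - ((ρ'₀ γ).val 1 1 : PadicAlgCl p)) < 1 :=
          (Summit.Langlands.Langlands.Theorems.FiveIsogenyEllipticCurves.sub_mem_maximalIdeal_iff_v hO _ _).mp hmm
        have h2 : Valued.v (((ρ'₀ γ).val 0 0 : PadicAlgCl p) - 1) < 1 :=
          (Summit.Langlands.Langlands.Theorems.FiveIsogenyEllipticCurves.sub_mem_maximalIdeal_iff_v hO _ 1).mp
            (hdiag γ).1
        have h3 := (hdiag γ).2
        have h5 := v_sub_lt_one (v_sub_lt_one h2 h1) h3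
        convert h5 using 2
        ring
    · rw [hconj]
      obtain ⟨hq10, hqin, -⟩ := hQ σ
      refine ⟨hq10, fun hσ => ⟨(hqin hσ).1, ?_⟩⟩
      rw [(hqin hσ).2, show ((k : ℤ) - 1) = ((k - 1 : ℕ) : ℤ) by
        rw [Nat.cast_sub (by omega : 1 ≤ k)]; norm_num, zpow_natCast]
  · -- (lev): inertia at `ℓ ∤ Mp` killed by `η̄` acts trivially
    intro w hwM hwp 𝔓 h𝔓 σ hσI hησ
    suffices hρσ : ρ σ = 1 by rw [hρ'apply, hρσ, mul_one, inv_mul_cancel]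
    set ℓ := ((Rat.HeightOneSpectrum.primesEquiv w : Nat.Primes) : ℕ) with hℓ
    have hℓprime : ℓ.Prime := (Rat.HeightOneSpectrum.primesEquiv w).2
    have hℓp : ℓ ≠ p := fun h => hwp ((natCast_mem_asIdeal_iff_primesEquiv w hpp).mpr h)
    have hℓM : ℓ ≠ M := fun h => hwM ((natCast_mem_asIdeal_iff_primesEquiv w hMp).mpr h)
    by_cases hℓN : ℓ ∣ N
    · haveI : Fact ℓ.Prime := ⟨hℓprime⟩
      have hval : padicValNat ℓ N = padicValNat ℓ (nebentypus g).conductor := by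
        rcases hlevel with h | h
        · rw [← h]
        · conv_lhs => rw [h]
          rw [padicValNat.mul (DirichletCharacter.conductor_ne_zero _) hMp.ne_zero,
            padicValNat.eq_zero_of_not_dvd
              (fun hd => hℓM ((Nat.prime_dvd_prime_iff_eq hℓprime hMp).mp hd)), add_zero]
      obtain ⟨Pℓ, hPℓ⟩ := hLev g hk2' hnew p ι ρ hρg hirr ℓ hℓprime hℓp hℓN hval w
        ((natCast_mem_asIdeal_iff_primesEquiv w hℓprime).mpr rfl) 𝔓 h𝔓
      obtain ⟨a, ha⟩ := hPℓ σ hσI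
      refine apply_eq_one_of_conj_eq_diagonal ρ σ Pℓ _ _ ha (htrall σ) hησ hpm ?_
      rw [← map_pow, ← MulChar.pow_apply_coe, hχm, MulChar.one_apply_coe, map_one]
    · refine (hρg w fun h => ?_).1 𝔓 h𝔓 σ hσI
      rcases (Nat.Prime.dvd_mul hℓprime).mp h with h' | h'
      · exact hℓN h'
      · exact hℓp ((Nat.prime_dvd_prime_iff_eq hℓprime hpp).mp h')
  · -- (mod): the L-algebraic cuspidal `π` of `g`
    intro hcpt
    obtain ⟨π, hπT, hSat⟩ := hGel g hk2' hnew hcpt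
    obtain ⟨hLalg, hreg⟩ := isLAlgebraic_isRegular_weight (k : ℤ) (by omega)
    refine ⟨ι, π, _, hπT, hLalg, hreg, ?_⟩
    rw [Filter.eventually_cofinite]
    refine (finite_setOf_primesEquiv_dvd (mul_ne_zero (NeZero.ne N) hpp.ne_zero)).subset
      fun w hw => ?_
    by_contra hwS
    apply hw
    have hprime := (Rat.HeightOneSpectrum.primesEquiv w).2
    have hndvd : ¬ ((Rat.HeightOneSpectrum.primesEquiv w : Nat.Primes) : ℕ) ∣ N * p := hwS
    obtain ⟨α', hα', hpoly⟩ := hSat _ hprime (fun h => hndvd (h.mul_right p)) w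
      ((natCast_mem_asIdeal_iff_primesEquiv w hprime).mpr rfl)
    obtain ⟨hunr, hfrob⟩ := hρg w hndvd
    exact satakeFrobCompatibleAt_of_newform g ι π _ w _ α' hα' hpoly
      ((FramedGaloisRep.isUnramifiedAt_conj_iff w P⁻¹ ρ).mpr hunr)
      ((hasFrobCharpolyAt_conj_iff w P⁻¹ ρ _).mpr hfrob)


end OddPackage

end Summit.Langlands.Langlands.Theorems.SkinnerWilesDefectOne.SeedOfQuadraticBaseChange

end
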